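import Summits.Langlands.Langlands.Theses.TameTypeSwitch

/-!
# EQUIVALENCE AUDIT — `TameTypeSwitch.SectorComplement` (stmt-Langlands-18277): position, kernel-checked

Planner scratch (crux-strategist `cstrat-stmt-Langlands-18277-q1`, suspect = equivalence, 2026-08-17).
The payload witness `Theorems.skinnerWilesDefectOne_sectorComplement_iff_of_target` concerns the
HOMONYMOUS decl `Theses.SkinnerWilesDefectOne.SectorComplement` (stmt-Langlands-12923,
`ReducibleOrdinaryModular → Langlands`); the same two-line position holds for THIS decl
(`SectorComplement := GappedWeightPA → Langlands`) and is recorded here together with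

* the exact conditioning set of the equivalence `SectorComplement ↔ Langlands`: the route TARGET
  `GappedWeightPA` (stmt-Langlands-18268), equivalently the two content cruxes `TameTypedWitness`
  (stmt-Langlands-18269, rank 2) and `TypedWitnessFLLifting` (stmt-Langlands-18270, rank 3) through the
  pure-logic composition `gappedWeightPA_of_cruxes` below — every one of which is OPEN on the ledger;
* a proof of the route's `Assembly` item (stmt-Langlands-18278) — it is glue BY KIND (two applications
  and one `∃`-repacking), so the fourth binder `hA : Assembly` of `closes` carries no content and the
  deciding theorem's effective binders are `TameTypedWitness`, `TypedWitnessFLLifting` (sector side) and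
  `SectorComplement` (the declared rest of the summit).

Nothing here asserts the item or its negation.
-/

set_option linter.dupNamespace false

namespace Summit.Langlands.Langlands.Cruxes.SectorComplement.EquivalenceAuditTameTypeSwitch

open Summit.Langlands.Langlands.Theses.TameTypeSwitch

/-- S → C: the frame is implied by the summit (discard the sector hypothesis). [folklore] -/
theorem tts_sectorComplement_of_langlands : _root_.Langlands → SectorComplement :=
  fun h _ ↦ h

/-- The witness's shape for THIS decl: under the route TARGET, `SectorComplement ↔ Langlands`.
[folklore] -/
theorem tts_sectorComplement_iff_of_target (hX : GappedWeightPA) :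
    SectorComplement ↔ _root_.Langlands :=
  ⟨fun hC ↦ hC hX, fun h _ ↦ h⟩

/-- The exact content of a refutation of the frame: prove the (open) sector theorem AND disprove the
formal summit. [folklore] -/
theorem tts_not_sectorComplement_iff : ¬ SectorComplement ↔ GappedWeightPA ∧ ¬ _root_.Langlands :=
  Classical.not_imp

/-- Truth table of the frame. [folklore] -/
theorem tts_sectorComplement_iff_not_or : SectorComplement ↔ ¬ GappedWeightPA ∨ _root_.Langlands :=
  imp_iff_not_or

set_option maxHeartbeats 400000 in
/-- **The content of the `Assembly` item, isolated**: the two content cruxes give the target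
(`TameTypedWitness` supplies `K'`, `hcpt'`, `τ'`, the weight-0 depth-zero witness `π` and its avatar
`r₀` with every transported hypothesis; `TypedWitnessFLLifting` over `F := K'` (CM branch) applied to
`ρ := r|Γ_{K'}` returns the regular algebraic, compatible, `ℓ`-unramified `Π`). Pure logic: two
applications and one `∃`-repacking; the gap clause `_hgap` of the target is NOT used (the cruxes
prove the gap-free strengthening of X). [folklore] -/
theorem gappedWeightPA_of_cruxes (hW : TameTypedWitness) (hL : TypedWitnessFLLifting) :
    GappedWeightPA := by
  intro K _ _ hK Kav _ _ hfd n B hn ℓ _ hℓn hℓB hunr k ι r τ hur hcr _hgap hres hirr hdg H hirrH hen hsc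
  obtain ⟨K', iF, iN, iA, hgal, hcm, hdisj, hunr', hcpt', τ', π, r₀, hur', hcr', hres', hirr', hdg',
      hirrH', hen', hsc', hw0, hcompat, hres₀, h𝔫⟩ :=
    hW K hK Kav hfd n B hn ℓ hℓn hℓB hunr ι r τ hur hcr hres hirr hdg hirrH hen hsc
  obtain ⟨Pi, hreg, hPicompat, hPiunr⟩ :=
    hL K' (Or.inr hcm) n B hcpt' ℓ hℓn hℓB hunr' ι (r.restrictField K') τ' π r₀ hur' hcr'
      hres' hirr' hdg' hirrH' hen' hsc' hw0 hcompat hres₀ h𝔫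
  exact ⟨K', iF, iN, iA, hgal, hcm, hdisj, hunr', hcpt', Pi, hreg, hPicompat, hPiunr⟩

/-- The route's `Assembly` item (stmt-Langlands-18278) holds: glue by kind. [folklore] -/
theorem tts_assembly_holds : Assembly :=
  fun hW hL hJ ↦ hJ (gappedWeightPA_of_cruxes hW hL)

/-- Hence the deciding theorem with its vacuous fourth binder discharged: the effective binders of
`closes` are the two content cruxes and the frame. [folklore] -/
theorem tts_closes_effective (hW : TameTypedWitness) (hL : TypedWitnessFLLifting)
    (hJ : SectorComplement) : _root_.Langlands :=
  closes hW hL hJ tts_assembly_holds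

/-- Under the two CONTENT cruxes (both OPEN items), `SectorComplement ↔ Langlands`
(`→` is the route's `closes` with the proved `Assembly` plugged in). So this item can close only
together with the summit once the route's own cruxes land. [folklore] -/
theorem tts_sectorComplement_iff_of_cruxes (hW : TameTypedWitness) (hL : TypedWitnessFLLifting) :
    SectorComplement ↔ _root_.Langlands :=
  ⟨fun hC ↦ tts_closes_effective hW hL hC, fun h _ ↦ h⟩

/-- The frame carries the summit's shared Statement debt: together with the route target it yields a
local Langlands datum for `GL_n(F_v)` at every finite place of every number field (the `llc` field of
the reciprocity data) — Harris–Taylor/Henniart content, far outside the gapped potential-automorphy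
cell over CM fields. [folklore] -/
theorem tts_sectorComplement_localLanglandsDebt (hC : SectorComplement) (hX : GappedWeightPA)
    (F : Type) [Field F] [NumberField F]
    (v : IsDedekindDomain.HeightOneSpectrum (NumberField.RingOfIntegers F)) :
    Nonempty (Literature.NumberTheory.Automorphic.LocalLanglandsDatum (v.adicCompletion F)) := by
  obtain ⟨⟨𝓡⟩, -⟩ := hC hX F
  exact ⟨𝓡.llc v⟩

end Summit.Langlands.Langlands.Cruxes.SectorComplement.EquivalenceAuditTameTypeSwitch
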